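import Literature.MathematicalPhysics.QuantumLattice.HubbardFreePropagator
import Literature.MathematicalPhysics.QuantumLattice.HubbardFermiLiquid
import HarnessLib

/-!
# The free (`U = 0`) two-point function `hubbardThermalTwoPoint` in momentum space

Topic `MathematicalPhysics/QuantumLattice`. Leaf module joining `HubbardFreePropagator.lean`
(BGM's free propagator (1.4) at equal times as an explicit momentum sum, stated for the Gibbs
functional `thermalCorr β H_L c†_{xσ} c_{yσ'}` of the free torus Hamiltonian
`H_L = hubbardTorusWith 2 L 1 0 μ`) with the definition `hubbardThermalTwoPoint` of
`HubbardFermiLiquid.lean` (the finite-volume two-point function `⟨c†_{xσ} c_{yσ'}⟩_{β,L}` whose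
`L → ∞` limit is the content of the named fact `bgm_two_point_limit`, Benfatto–Giuliani–Mastropietro
2006, Thm. 1.1): for `3 ≤ L`,

* `hubbardThermalTwoPoint_zero_interaction_eq_sum` —
  `⟨c†_{xσ} c_{yσ'}⟩_{β,L,U=0} = δ_{σσ'} L⁻² Σ_{k ∈ (ℤ/Lℤ)²} χ_k(y - x) f_β(ε_L(k) - μ)`;
* `hubbardThermalTwoPoint_zero_interaction_eq_sum_latticeMomentum` —
  `⟨c†_{xσ} c_{yσ'}⟩_{β,L,U=0} = δ_{σσ'} L⁻² Σ_{k ∈ (ℤ/Lℤ)²} F_{β,μ,y-x}(2πk/L)`.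

Both are one-line corollaries (unfold `hubbardThermalTwoPoint` at `L ≠ 0`) of
`thermalCorr_hubbardTorusWith_zero_interaction_eq_sum{,_latticeMomentum}`; they were first proved
in `HubbardFreePropagator.lean` and live here so that the free-propagator layer
(`HubbardFreePropagator` → `HubbardFreeCovariance` → `HubbardEffectiveAction(CT)` → …) does not
import `HubbardFermiLiquid.lean` and its unproved named fact (import hygiene; no new mathematics,
fully-qualified names unchanged).

## References

* G. Benfatto, A. Giuliani, V. Mastropietro, *Fermi liquid behavior in the 2D Hubbard model at
  low temperatures*, Ann. Henri Poincaré 7 (2006) 809–898, §1.2, eq. (1.4).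
  [BenfattoGiulianiMastropietro2006]
-/

noncomputable section

open Matrix Finset
open Literature.Probability.LatticeModels

namespace Literature.MathematicalPhysics.QuantumLattice

/-- **BGM's free propagator at equal times, finite volume.** For `L ≥ 3` the `U = 0`
two-point function of `bgm_two_point_limit` is
`⟨c†_{xσ} c_{yσ'}⟩_{β,L,U=0} = δ_{σσ'} L⁻² Σ_{k ∈ (ℤ/Lℤ)²} χ_k(y - x) f_β(ε_L(k) - μ)`,
`χ_k(z) = e^{2πi k·z/L}`, `ε_L(k) = -2(cos(2πk₁/L) + cos(2πk₂/L))`, `f_β(E) = (1 + e^{βE})⁻¹`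
(BGM 2006 eq. (1.4) after the Matsubara sum, in the tree's hopping-`1` convention).
[cite: BenfattoGiulianiMastropietro2006, eq. (1.4)] -/
theorem hubbardThermalTwoPoint_zero_interaction_eq_sum {L : ℕ} (hL : 3 ≤ L) (β μ : ℝ)
    (x y : Site 2) (σ σ' : Fin 2) :
    hubbardThermalTwoPoint β 0 μ L x y σ σ' =
      haveI : NeZero L := ⟨by omega⟩
      if σ = σ' then
        ((L : ℂ) ^ 2)⁻¹ * ∑ k : TorusSite 2 L,
          torusChar k (Torus.proj L y - Torus.proj L x) * (fermiFunction β (torusBand L k - μ) : ℂ)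
      else 0 := by
  haveI : NeZero L := ⟨by omega⟩
  unfold hubbardThermalTwoPoint
  rw [dif_neg (NeZero.ne L)]
  exact thermalCorr_hubbardTorusWith_zero_interaction_eq_sum hL β μ x y σ σ'

/-- **The free two-point function as a Riemann sum over the lattice momenta** (`L ≥ 3`):
`⟨c†_{xσ} c_{yσ'}⟩_{β,L,U=0} = δ_{σσ'} L⁻² Σ_{k ∈ (ℤ/Lℤ)²} F_{β,μ,y-x}(2πk/L)`.
BGM 2006, eq. (1.4). [cite: BenfattoGiulianiMastropietro2006, eq. (1.4)] -/
theorem hubbardThermalTwoPoint_zero_interaction_eq_sum_latticeMomentum {L : ℕ} (hL : 3 ≤ L)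
    (β μ : ℝ) (x y : Site 2) (σ σ' : Fin 2) :
    hubbardThermalTwoPoint β 0 μ L x y σ σ' =
      haveI : NeZero L := ⟨by omega⟩
      if σ = σ' then
        ((L : ℂ) ^ 2)⁻¹ *
          ∑ k : TorusSite 2 L, freePropagatorIntegrand β μ (y - x) (latticeMomentum L k)
      else 0 := by
  haveI : NeZero L := ⟨by omega⟩
  unfold hubbardThermalTwoPoint
  rw [dif_neg (NeZero.ne L)]
  exact thermalCorr_hubbardTorusWith_zero_interaction_eq_sum_latticeMomentum hL β μ x y σ σ'

end Literature.MathematicalPhysics.QuantumLattice
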